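import Summits.Ventures.YMGap.RobustBall.TruncationConvergenceStar
import Summits.Ventures.YMGap.RobustBall.DirectionalSusceptibilityStar
import Summits.Ventures.YMGap.RobustBall.StateDerivativeOnBallS
import HarnessLib

/-!
# Venture YMGap, track ROBUST-BALL (Y2) — THROUGH THE STAR DOOR: the state is differentiable along every direction of ds-2's gauge-invariant
# ball, and the derivative of every local expectation is the susceptibility series (the star twin of `StateDerivativeOnBallS`)

HONEST FRAMING. WHAT THIS IS: a venture file (cell `pub-ymgap`, track Y2 ROBUST-BALL, seat rb-p1, theorems only).  Setting: `(W, supp)`,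
direction `(V, suppV)` in `MemBallZdG`, a UNIFORM star window bound (radius `D ≥ max R R_V + 2`, received sum `0 ≤ ρ < 1`) for every truncated
or full line `W + s·𝟙_T V`, `|s| ≤ s₀` (`T` any set of terms) — supplied on the cell's balls by `BallClosureZdG` + ds-2's robust star door —,
oscillation witnesses of `V` of window load `≤ B_V`, Frobenius-Lipschitz witnesses of `V` of total load `≤ L` through every link.
* `perturbedYM_congr_of_isSupportedBy` / `perturbedGibbsMeasures_congr_of_isSupportedBy` — the tier-1 specification and its DLR set do not
  depend on the choice of supporting family (`hamiltonianIn_congr_of_isSupportedBy`);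
* ★ `hasDerivAt_and_continuousOn_direction_star` — for the DLR states `ν(s)` of `W + sV` and every bounded measurable local observable `F` with a
  Frobenius-Lipschitz vector: `HasDerivAt (s ↦ ∫ F dν(s)) (−Σ'_X cov_{ν(s)}(F, V_X)) s` at every `|s| < s₀`, and the susceptibility series is
  continuous on `[-s₀, s₀]`; `contDiffOn_integral_direction_star` — hence `C¹`.  Ingredients: Feynman–Hellmann along the truncated lines
  (`LocalSourceResponse`), termwise uniform convergence of the covariances (`TruncationConvergenceStar`), the summable star majorant
  (`StarDoorZdGeometric.abs_covariance_le_of_starWindowBoundZdR_geometric` + `DirectionalSusceptibilityStar.pow_floor_le_exp`), Layer A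
  (`TruncatedSeriesDerivative`).
WHAT THIS IS NOT: the `SU(2)` cell up to `β_W = 1/3` (next file: the uniform star bound along the lines from the robust star certificates); analyticity;
one-sided comparison constants; lattice strong coupling only; nothing about the continuum limit or a Clay-sense mass gap.
-/

noncomputable section

open MeasureTheory ProbabilityTheory Function Finset Real Filter Topology
open scoped NNReal
open Literature.Probability.LatticeModels
open Literature.Probability.LatticeModels.DobrushinMetric
open Literature.MathematicalPhysics.QuantumLattice
open Literature.MathematicalPhysics.QuantumFieldTheory hiding ZdEdge
open Summit.Ventures.YMGap.DSWindowZd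

namespace Summit.Ventures.YMGap.RobustBall

/-! ### The tier-1 specification does not depend on the supporting family -/

/-- Two families supporting the same potential give the same finite-volume Hamiltonians (both list every active set meeting the volume; the
other listed sets contribute `0`). -/
theorem hamiltonianIn_congr_of_isSupportedBy {V S : Type*} [DecidableEq V] {Φ : Potential V S} {f₁ f₂ : Finset V → Finset (Finset V)}
    (h₁ : Φ.IsSupportedBy f₁) (h₂ : Φ.IsSupportedBy f₂) : hamiltonianIn Φ f₁ = hamiltonianIn Φ f₂ := by
  classical
  have key : ∀ {g₁ g₂ : Finset V → Finset (Finset V)}, Φ.IsSupportedBy g₁ → ∀ Λ σ,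
      hamiltonianIn Φ g₁ Λ σ = ∑ A ∈ (g₁ Λ ∪ g₂ Λ) with (A ∩ Λ).Nonempty, Φ A σ := by
    intro g₁ g₂ hg₁ Λ σ
    unfold hamiltonianIn
    refine Finset.sum_subset (Finset.filter_subset_filter _ Finset.subset_union_left) fun A hA hA' => ?_
    obtain ⟨-, hne⟩ := Finset.mem_filter.1 hA
    by_contra hΦ
    have hΦ' : Φ A ≠ 0 := fun h0 => hΦ (by rw [h0]; rfl)
    exact hA' (Finset.mem_filter.2 ⟨hg₁ Λ A hne hΦ', hne⟩)
  funext Λ σ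
  rw [key h₁ Λ σ, key h₂ Λ σ, Finset.union_comm]

section Congr

variable {d : ℕ} {G : Type*} [Group G] [TopologicalSpace G] [IsTopologicalGroup G] [CompactSpace G] [MeasurableSpace G] [BorelSpace G]
  {n : ℕ} (ρ : G →* Matrix (Fin n) (Fin n) ℂ)

/-- **The tier-1 specification does not depend on the choice of supporting family.** -/
theorem perturbedYM_congr_of_isSupportedBy (β : ℝ) {W : Potential (ZdEdge d) G} {f₁ f₂ : Finset (ZdEdge d) → Finset (Finset (ZdEdge d))}
    (h₁ : W.IsSupportedBy f₁) (h₂ : W.IsSupportedBy f₂) : perturbedYM ρ β W f₁ = perturbedYM ρ β W f₂ := by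
  classical
  have hE : perturbedEnergy ρ β W f₁ = perturbedEnergy ρ β W f₂ := by
    funext Λ U
    simp only [perturbedEnergy, hamiltonianIn_congr_of_isSupportedBy h₁ h₂]
  funext Λ η
  simp only [perturbedYM, hE]

/-- Hence neither does the set of DLR states. -/
theorem perturbedGibbsMeasures_congr_of_isSupportedBy (β : ℝ) {W : Potential (ZdEdge d) G}
    {f₁ f₂ : Finset (ZdEdge d) → Finset (Finset (ZdEdge d))} (h₁ : W.IsSupportedBy f₁) (h₂ : W.IsSupportedBy f₂) :
    perturbedGibbsMeasures ρ β W f₁ = perturbedGibbsMeasures ρ β W f₂ := by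
  simp only [perturbedGibbsMeasures, perturbedYM_congr_of_isSupportedBy ρ β h₁ h₂]

end Congr

/-! ### The derivative along a direction through the star door -/

section Main

variable {d N : ℕ} {W V : Potential (ZdEdge d) (SUN N)} {supp suppV : Finset (ZdEdge d) → Finset (Finset (ZdEdge d))}

/-- ★ **THROUGH THE STAR DOOR, THE STATE IS DIFFERENTIABLE ALONG EVERY DIRECTION OF THE GAUGE-INVARIANT BALL, WITH DERIVATIVE THE
SUSCEPTIBILITY SERIES.**  `(W, supp) ∈ MemBallZdG ε₀ ε₁ R`, direction `(V, suppV) ∈ MemBallZdG ε₀V ε₁V R_V` with oscillation witnesses of window load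
`≤ B_V` on every vertex star and Frobenius-Lipschitz witnesses `lipV` of total load `≤ L` through every link; a uniform star window bound (radius
`D ≥ max R R_V + 2`, received sum `0 ≤ ρ < 1`) for `W + s·𝟙_T V`, every set of terms `T`, every `|s| ≤ s₀`; `ν(s)` the DLR states of `W + sV` on
`|s| ≤ s₀`; `F` bounded measurable local with a Frobenius-Lipschitz vector.  Then (i) `HasDerivAt (s ↦ ∫ F dν(s)) (−Σ'_X cov_{ν(s)}(F, V_X)) s` at
every `|s| < s₀`; (ii) `s ↦ Σ'_X cov_{ν(s)}(F, V_X)` is continuous on `[-s₀, s₀]`. -/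
theorem hasDerivAt_and_continuousOn_direction_star (hd : 1 ≤ d) {β ε₀ ε₁ ε₀V ε₁V s₀ ρ BV L : ℝ} {R RV D : ℕ}
    (hW : MemBallZdG ε₀ ε₁ R W supp) (hV : MemBallZdG ε₀V ε₁V RV V suppV) (h₀V : 0 ≤ ε₀V) (h₁V : 0 ≤ ε₁V)
    {oscV : Finset (ZdEdge d) → ZdEdge d → ℝ} (hoscV : ∀ X, Dobrushin.IsOscBound (V X) (oscV X))
    (hBV : ∀ c : ZdEdge d, windowLoad d suppV oscV (starWinZd c) ≤ BV) (hBV0 : 0 ≤ BV) (hs₀ : 0 < s₀)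
    (hD : max R RV + 2 ≤ D) (hρ0 : 0 ≤ ρ) (hρ1 : ρ < 1)
    (hwin : ∀ (T : Set (Finset (ZdEdge d))) (s : ℝ), |s| ≤ s₀ → StarWindowBoundZdR d N
      (perturbedYM (d := d) (fundamentalRep (Fin N)) (N * β) (W + s • T.indicator V) (fun Λ => supp Λ ∪ suppV Λ)) D ρ suFrobDist)
    {lipV : Finset (ZdEdge d) → ZdEdge d → ℝ} (hlipV : ∀ X, IsLipBound suFrobDist (V X) (lipV X))
    (hLs : ∀ e, Summable fun X : Finset (ZdEdge d) => (if e ∈ X then ∑ y ∈ X, lipV X y else 0))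
    (hL : ∀ e, ∑' X : Finset (ZdEdge d), (if e ∈ X then ∑ y ∈ X, lipV X y else 0) ≤ L)
    {ν : ℝ → Measure (LGConfig d (SUN N))}
    (hν : ∀ s ∈ Set.Icc (-s₀) s₀, ν s ∈ perturbedGibbsMeasures (d := d) (fundamentalRep (Fin N)) (N * β) (W + s • V)
      (fun Λ => supp Λ ∪ suppV Λ))
    {F : LGConfig d (SUN N) → ℝ} (hFm : Measurable F) {ΛF : Finset (ZdEdge d)} (hFdep : DependsOn F (↑ΛF : Set (ZdEdge d)))
    {MF : ℝ} (hMF : ∀ σ, |F σ| ≤ MF) {δF : ZdEdge d → ℝ} (hδF : IsLipBound suFrobDist F δF) :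
    (∀ s ∈ Set.Ioo (-s₀) s₀, HasDerivAt (fun s => ∫ U, F U ∂(ν s)) (-(∑' X : Finset (ZdEdge d), cov[F, V X; ν s])) s) ∧
      ContinuousOn (fun s => ∑' X : Finset (ZdEdge d), cov[F, V X; ν s]) (Set.Icc (-s₀) s₀) := by
  classical
  haveI : SecondCountableTopology (Matrix (Fin N) (Fin N) ℂ) :=
    inferInstanceAs (SecondCountableTopology (Fin N → Fin N → ℂ))
  haveI : SecondCountableTopology (SUN N) := Topology.IsEmbedding.subtypeVal.secondCountableTopology
  set I : Set ℝ := Set.Ioo (-s₀) s₀ with hI; set J : Set ℝ := Set.Icc (-s₀) s₀ with hJ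
  have hII : I ⊆ J := Set.Ioo_subset_Icc_self
  have habs : ∀ {s}, s ∈ J → |s| ≤ s₀ := fun hs => abs_le.2 ⟨by linarith [hs.1], hs.2⟩
  set fam : Finset (ZdEdge d) → Finset (Finset (ZdEdge d)) := fun Λ => supp Λ ∪ suppV Λ with hfam
  obtain ⟨T, hT⟩ := exists_term_exhaustion d
  have hT' : ∀ A : Finset (ZdEdge d), V A ≠ 0 → ∀ᶠ n in atTop, A ∈ T n := fun A _ =>
    (tendsto_atTop.1 hT {A}).mono fun n hn => hn (Finset.mem_singleton_self A)
  -- members along the lines (big ball, family `fam`)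
  have hline : ∀ (Tset : Set (Finset (ZdEdge d))) {s : ℝ}, |s| ≤ s₀ →
      MemBallZdG (ε₀ + s₀ * ε₀V) (ε₁ + s₀ * ε₁V) (max R RV) (W + s • Tset.indicator V) fam :=
    fun Tset s hs => hW.add_smul_indicator hV h₀V h₁V le_rfl le_rfl hs Tset
  -- the base `W` itself with family `fam`: uniqueness and a state `μ`
  have hW' : MemBallZdG (ε₀ + s₀ * ε₀V) (ε₁ + s₀ * ε₁V) (max R RV) W fam := by
    have h := hline ∅ (s := 0) (by rw [abs_zero]; exact hs₀.le)
    rwa [Set.indicator_empty', smul_zero, add_zero] at h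
  have hwin0 : StarWindowBoundZdR d N (perturbedYM (d := d) (fundamentalRep (Fin N)) (N * β) W fam) D ρ suFrobDist := by
    have h := hwin ∅ 0 (by rw [abs_zero]; exact hs₀.le)
    rwa [Set.indicator_empty', smul_zero, add_zero] at h
  have hgap := perturbedMassGapAt_of_starWindowBoundZdR hW'.continuous hW'.dependsOn hW'.supportedBy hW'.range hD hρ0 hρ1 hwin0
  have huniq : (perturbedGibbsMeasures (d := d) (fundamentalRep (Fin N)) (N * β) W fam).Subsingleton := hgap.1.1
  obtain ⟨μ, hμ⟩ := hgap.1.2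
  have hμ' : μ ∈ perturbedGibbsMeasures (d := d) (fundamentalRep (Fin N)) (N * β) W fam := hμ
  have hWA : W.IsAdapted := fun X => ⟨hW.dependsOn X, (hW.continuous X).measurable⟩
  have hWb : ∀ X, ∃ C, ∀ U, |W X U| ≤ C := fun X => exists_bound_of_continuous (hW.continuous X)
  have hVb : ∀ X, ∃ C, ∀ U, |V X U| ≤ C := fun X => exists_bound_of_continuous (hV.continuous X)
  -- the truncated directions and the tilted states along the truncated lines
  set Vn : ℕ → Potential (ZdEdge d) (SUN N) := fun n => (↑(T n) : Set (Finset (ZdEdge d))).indicator V with hVn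
  have hVnc : ∀ n X, Continuous (Vn n X) := fun n X => continuous_indicator_apply hV.continuous X
  have hVndep : ∀ n X, DependsOn (Vn n X) (↑X : Set (ZdEdge d)) := fun n X => dependsOn_indicator_apply hV.dependsOn X
  have hVnA : ∀ n, (Vn n).IsAdapted := fun n X => ⟨hVndep n X, (hVnc n X).measurable⟩
  have hVnb : ∀ n X, ∃ C, ∀ U, |Vn n X U| ≤ C := fun n X => exists_bound_of_continuous (hVnc n X)
  have hVnsupp : ∀ n, (Vn n).IsSupportedBy fun _ => T n := fun n => isSupportedBy_indicator (T n) V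
  set νn : ℕ → ℝ → Measure (LGConfig d (SUN N)) := fun n s => μ.tilted fun U => -s * ∑ A ∈ T n, Vn n A U with hνn_def
  have hνn₁ : ∀ n s, νn n s ∈ perturbedGibbsMeasures (d := d) (fundamentalRep (Fin N)) (N * β) (W + s • Vn n)
      (fun Λ => fam Λ ∪ T n) := fun n s => by
    rw [perturbedGibbsMeasures_add_smul_eq_singleton (fundamentalRep (Fin N)) (continuous_fundamentalRep (Fin N)) (N * β) hWA hWb
      hW'.supportedBy (hVnA n) (hVnb n) (hVnsupp n) (fun _ => subset_rfl) huniq hμ' s]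
    exact Set.mem_singleton _
  -- the same states listed by the family `fam` (the DLR set does not depend on the supporting family)
  have hνn : ∀ n s, s ∈ J → νn n s ∈ perturbedGibbsMeasures (d := d) (fundamentalRep (Fin N)) (N * β) (W + s • Vn n) fam := by
    intro n s hs
    have h1 : (W + s • Vn n).IsSupportedBy (fun Λ => fam Λ ∪ T n) := by
      refine isSupportedBy_add_union hW'.supportedBy fun Λ A hA hne => hVnsupp n Λ A hA fun h0 => hne ?_
      rw [Pi.smul_apply, h0, smul_zero]
    rw [perturbedGibbsMeasures_congr_of_isSupportedBy (fundamentalRep (Fin N)) (N * β) (hline _ (habs hs)).supportedBy h1]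
    exact hνn₁ n s
  have hprob_n : ∀ n s, IsProbabilityMeasure (νn n s) := fun n s => (show IsGibbsMeasure _ _ from hνn₁ n s).isProbabilityMeasure
  have hprob : ∀ s ∈ J, IsProbabilityMeasure (ν s) := fun s hs => (show IsGibbsMeasure _ _ from hν s hs).isProbabilityMeasure
  -- (a) Feynman–Hellmann along the truncated lines
  have hderiv : ∀ n, ∀ s ∈ I, HasDerivAt (fun s => ∫ U, F U ∂(νn n s)) (-(∑ X ∈ T n, cov[F, V X; νn n s])) s := by
    intro n s _
    have h := hasDerivAt_integral_of_mem_perturbedGibbsMeasures_add_smul (fundamentalRep (Fin N)) (continuous_fundamentalRep (Fin N))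
      (N * β) hWA hWb hW'.supportedBy (hVnA n) (hVnb n) (hVnsupp n) (fun _ => subset_rfl) huniq hμ' (hνn₁ n) hFm hMF s
    haveI := hprob_n n s
    have hF2 : MemLp F 2 (νn n s) := MemLp.of_bound hFm.aestronglyMeasurable MF (Eventually.of_forall fun σ => by
      rw [Real.norm_eq_abs]; exact hMF σ)
    have hV2 : ∀ A ∈ T n, MemLp (fun U => Vn n A U) 2 (νn n s) := fun A _ => by
      obtain ⟨C, hC⟩ := hVnb n A
      exact MemLp.of_bound (hVnc n A).measurable.aestronglyMeasurable C (Eventually.of_forall fun σ => by rw [Real.norm_eq_abs]; exact hC σ)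
    have hcov : cov[F, fun U => ∑ A ∈ T n, Vn n A U; νn n s] = ∑ X ∈ T n, cov[F, V X; νn n s] := by
      rw [covariance_fun_sum_right' hV2 hF2]
      refine sum_congr rfl fun X hX => ?_
      simp only [hVn, Set.indicator_of_mem (Finset.mem_coe.2 hX)]
    rwa [hcov] at h
  -- (b) uniform convergence of expectations along the truncations (screened stability through the star door)
  have hunif : ∀ {g : LGConfig d (SUN N) → ℝ} {Δ : Finset (ZdEdge d)} {M : ℝ} {δ : ZdEdge d → ℝ},
      Measurable g → DependsOn g (↑Δ : Set (ZdEdge d)) → (∀ σ, |g σ| ≤ M) → IsLipBound suFrobDist g δ →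
      TendstoUniformlyOn (fun n s => ∫ σ, g σ ∂(νn n s)) (fun s => ∫ σ, g σ ∂(ν s)) atTop J :=
    fun hgm hgdep hM hδ => tendstoUniformlyOn_integral_truncation_star hW hV hoscV hBV hBV0 hs₀.le h₀V h₁V hD hρ0 hρ1 (T := T)
      (fun n s hs => hwin _ s hs) hT' hνn hν hgm hM hgdep hδ
  -- (c) one summable majorant for all covariances of all states of all members along the lines
  set ρ' : ℝ := max ρ (1 / 2) with hρ'
  have hρ'0 : 0 < ρ' := lt_of_lt_of_le (by norm_num) (le_max_right _ _)
  have hρ'1 : ρ' < 1 := max_lt hρ1 (by norm_num)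
  set t : ℝ := -Real.log ρ' / (D + 2 : ℕ) with ht
  have hlogneg : 0 < -Real.log ρ' := by have := Real.log_neg hρ'0 hρ'1; linarith
  have htpos : 0 < t := div_pos hlogneg (by positivity)
  set A₀ : ℝ := 2 * (2 * Real.sqrt N) ^ 2 * (∑ y ∈ ΛF, δF y) * ρ'⁻¹ with hA₀
  set LX : Finset (ZdEdge d) → ℝ := fun X => ∑ y ∈ X, lipV X y with hLX
  set g₀ : ZdEdge d → ℝ := fun e => exp (-t * linkSetDist ΛF e) with hg₀
  set Φ : Finset (ZdEdge d) → ℝ := fun X => A₀ * LX X * ∑ e ∈ X, g₀ e with hΦ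
  have hδ0 : 0 ≤ ∑ y ∈ ΛF, δF y := sum_nonneg fun y _ => hδF.nonneg y
  have hA₀0 : 0 ≤ A₀ := by positivity
  have hLX0 : ∀ X, 0 ≤ LX X := fun X => sum_nonneg fun y _ => (hlipV X).nonneg y; have hg₀0 : ∀ e, 0 ≤ g₀ e := fun e => (exp_pos _).le
  have hΦ0 : ∀ X, 0 ≤ Φ X := fun X => mul_nonneg (mul_nonneg hA₀0 (hLX0 X)) (sum_nonneg fun e _ => hg₀0 e)
  have hd0 : 0 < d := hd
  have hL0 : 0 ≤ L := le_trans (tsum_nonneg fun X => by split_ifs; exacts [hLX0 X, le_rfl]) (hL (0, ⟨0, hd0⟩))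
  have hΦs : Summable Φ := by
    refine summable_of_sum_le hΦ0 (c := A₀ * L * (ΛF.card * (d * ((1 + exp (-(t / d))) / (1 - exp (-(t / d)))) ^ d)))
      fun Tf => ?_
    have h1 : ∑ X ∈ Tf, Φ X = A₀ * ∑ X ∈ Tf, LX X * ∑ e ∈ X, g₀ e := by rw [mul_sum]; exact sum_congr rfl fun X _ => by ring
    rw [h1]
    by_cases hΛF : ΛF.Nonempty
    · obtain ⟨hgs, hgt⟩ := summable_exp_neg_linkSetDist hd htpos hΛF
      calc A₀ * ∑ X ∈ Tf, LX X * ∑ e ∈ X, g₀ e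
          ≤ A₀ * (L * (ΛF.card * (d * ((1 + exp (-(t / d))) / (1 - exp (-(t / d)))) ^ d))) :=
            mul_le_mul_of_nonneg_left ((sum_mul_sum_le_of_load hg₀0 hgs hLX0 hL0 hLs hL).trans
              (mul_le_mul_of_nonneg_left hgt hL0)) hA₀0
        _ = _ := by ring
    · simp [hA₀, Finset.not_nonempty_iff_eq_empty.1 hΛF]
  have hD1 : 1 ≤ D := by omega
  have hbound : ∀ (Tset : Set (Finset (ZdEdge d))) {s : ℝ}, s ∈ J → ∀ {μ' : Measure (LGConfig d (SUN N))},
      μ' ∈ perturbedGibbsMeasures (d := d) (fundamentalRep (Fin N)) (N * β) (W + s • Tset.indicator V) fam → ∀ X, |cov[F, V X; μ']| ≤ Φ X := by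
    intro Tset s hs μ' hμ'' X
    have hm := hline Tset (habs hs)
    have hmA : (W + s • Tset.indicator V).IsAdapted := fun X => ⟨hm.dependsOn X, (hm.continuous X).measurable⟩
    have hmb : ∀ X, ∃ C, ∀ U, |(W + s • Tset.indicator V) X U| ≤ C := fun X => exists_bound_of_continuous (hm.continuous X)
    have hγ : IsSpecification (perturbedYM (d := d) (fundamentalRep (Fin N)) (N * β) (W + s • Tset.indicator V) fam) :=
      isSpecification_perturbedYM _ (continuous_fundamentalRep (Fin N)) _ hmA hmb hm.supportedBy
    have hloc : ∀ (c : ZdEdge d) (ζ ζ' : LGConfig d (SUN N)), (∀ v ∈ starNbhdZdR D c.1, ζ v = ζ' v) →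
        ∀ (g : LGConfig d (SUN N) → ℝ), Measurable g → (∃ B, ∀ σ, |g σ| ≤ B) → DependsOn g (starWinZd c : Set (ZdEdge d)) →
          ∫ σ, g σ ∂(perturbedYM (d := d) (fundamentalRep (Fin N)) (N * β) (W + s • Tset.indicator V) fam (starWinZd c) ζ) =
            ∫ σ, g σ ∂(perturbedYM (d := d) (fundamentalRep (Fin N)) (N * β) (W + s • Tset.indicator V) fam (starWinZd c) ζ') :=
      fun c ζ ζ' hζ g hgm _ hgdep => perturbed_star_hloc _ (continuous_fundamentalRep (Fin N)) _ (fun X => (hm.continuous X).measurable)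
        hm.dependsOn hm.supportedBy hm.range hD c ζ ζ' hζ g hgm hgdep
    obtain ⟨CX, hCX⟩ := hVb X
    have h1 := abs_covariance_le_of_starWindowBoundZdR_geometric hγ hD1 hloc hρ0 hρ1 (hwin Tset s (habs hs)) hμ'' hFm
      (hV.continuous X).measurable hMF hCX hFdep (hV.dependsOn X) hδF (hlipV X)
    have h2 : |cov[F, V X; μ']| ≤ A₀ * LX X * exp (-(t * setDistEdges ΛF X)) := by
      refine h1.trans ?_
      have hp := pow_floor_le_exp (x := setDistEdges ΛF X) hρ0 hρ1 D
      calc 2 * (2 * Real.sqrt N) ^ 2 * ρ ^ ⌊setDistEdges ΛF X / (D + 2 : ℕ)⌋₊ * (∑ x ∈ ΛF, δF x) * ∑ y ∈ X, lipV X y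
          ≤ 2 * (2 * Real.sqrt N) ^ 2 * (ρ'⁻¹ * exp (-(-Real.log ρ' / (D + 2 : ℕ)) * setDistEdges ΛF X)) * (∑ x ∈ ΛF, δF x) *
              ∑ y ∈ X, lipV X y := by gcongr; exact hLX0 X
        _ = A₀ * LX X * exp (-(t * setDistEdges ΛF X)) := by simp only [hA₀, hLX, ht, neg_mul]; ring
    refine le_mul_sum_exp_of_le_mul_exp htpos.le hA₀0 (hLX0 X) h2 (fun hX => ?_) (fun hΔ => ?_)
    · simp only [hLX, Finset.not_nonempty_iff_eq_empty.1 hX, sum_empty]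
    · simp only [hA₀, Finset.not_nonempty_iff_eq_empty.1 hΔ, sum_empty, mul_zero, zero_mul]
  have hc' : ∀ n, ∀ s ∈ J, ∀ X, |cov[F, V X; νn n s]| ≤ Φ X := fun n s hs X => hbound _ hs (hνn n s hs) X
  have hcinf : ∀ s ∈ J, ∀ X, |cov[F, V X; ν s]| ≤ Φ X := fun s hs X => by
    have h := hν s hs
    rw [← Set.indicator_univ V] at h
    exact hbound Set.univ hs h X
  -- (d) termwise uniform convergence of the covariances
  have hMF0 : 0 ≤ MF := (abs_nonneg _).trans (hMF fun _ => 1)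
  have hconv : ∀ X, TendstoUniformlyOn (fun n s => cov[F, V X; νn n s]) (fun s => cov[F, V X; ν s]) atTop J := by
    intro X
    obtain ⟨CX, hCX⟩ := hVb X
    have hCX0 : 0 ≤ CX := (abs_nonneg _).trans (hCX fun _ => 1)
    exact tendstoUniformlyOn_cov (fun n s _ => hprob_n n s) (fun s hs => hprob s hs) hFm (hV.continuous X).measurable hMF0 hCX0
      hMF hCX (hunif hFm hFdep hMF hδF) (hunif (hV.continuous X).measurable (hV.dependsOn X) hCX (hlipV X))
      (hunif (hFm.mul (hV.continuous X).measurable) (dependsOn_mul_union hFdep (hV.dependsOn X))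
        (fun σ => by rw [abs_mul]; exact mul_le_mul (hMF σ) (hCX σ) (abs_nonneg _) hMF0)
        (isLipBound_mul_of_abs_le (fun _ _ => suFrobDist_nonneg _ _) hMF0 hCX0 hMF hCX hδF (hlipV X)))
  -- (e) each truncated susceptibility sum is continuous in `s` (tilt formula), hence so is the uniform limit
  have hcont : ∀ n, ContinuousOn (fun s => ∑ X ∈ T n, cov[F, V X; νn n s]) J := by
    intro n
    choose CA hCA using fun A => exists_bound_of_continuous (hVnc n A)
    have hHm : Measurable fun U : LGConfig d (SUN N) => ∑ A ∈ T n, Vn n A U := Finset.measurable_sum _ fun A _ => (hVnc n A).measurable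
    have hHb : ∀ U : LGConfig d (SUN N), |∑ A ∈ T n, Vn n A U| ≤ ∑ A ∈ T n, CA A := fun U =>
      (Finset.abs_sum_le_sum_abs _ _).trans (Finset.sum_le_sum fun A _ => hCA A U)
    haveI := (show IsGibbsMeasure _ μ from hμ').isProbabilityMeasure
    have hint : ∀ {g : LGConfig d (SUN N) → ℝ} {M : ℝ}, Measurable g → (∀ σ, |g σ| ≤ M) → Continuous fun s => ∫ σ, g σ ∂(νn n s) :=
      fun hgm hM => continuous_iff_continuousAt.2 fun s =>
        (hasDerivAt_integral_tilted_of_bounded (μ := μ) hHm hHb hgm.aestronglyMeasurable hM s).continuousAt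
    refine continuousOn_finsetSum _ fun X _ => Continuous.continuousOn ?_
    obtain ⟨CX, hCX⟩ := hVb X
    have hF2 : ∀ s, MemLp F 2 (νn n s) := fun s =>
      MemLp.of_bound hFm.aestronglyMeasurable MF (Eventually.of_forall fun σ => by rw [Real.norm_eq_abs]; exact hMF σ)
    have hV2 : ∀ s, MemLp (V X) 2 (νn n s) := fun s => MemLp.of_bound (hV.continuous X).measurable.aestronglyMeasurable CX
      (Eventually.of_forall fun σ => by rw [Real.norm_eq_abs]; exact hCX σ)
    have heq : (fun s => cov[F, V X; νn n s]) = fun s => (∫ σ, F σ * V X σ ∂(νn n s)) - (∫ σ, F σ ∂(νn n s)) * ∫ σ, V X σ ∂(νn n s) :=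
      funext fun s => by rw [covariance_eq_sub (hF2 s) (hV2 s)]; rfl
    rw [heq]
    exact (hint (g := fun σ => F σ * V X σ) (hFm.mul (hV.continuous X).measurable) (M := MF * CX)
      (fun σ => by rw [abs_mul]; exact mul_le_mul (hMF σ) (hCX σ) (abs_nonneg _) hMF0)).sub
      ((hint hFm hMF).mul (hint (hV.continuous X).measurable hCX))
  have hU := tendstoUniformlyOn_finsetSum_tsum hT hΦ0 hΦs hc' hcinf hconv
  -- (f) assemble
  exact ⟨fun s hs => hasDerivAt_of_truncations hT hΦ0 hΦs isOpen_Ioo (fun n s hs X => hc' n s (hII hs) X)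
      (fun s hs X => hcinf s (hII hs) X) (fun X => (hconv X).mono hII) hderiv
      (fun s hs => (hunif hFm hFdep hMF hδF).tendsto_at (hII hs)) hs,
    hU.continuousOn (Eventually.of_forall hcont).frequently⟩

/-- ★ **THE STATE IS `C¹` ALONG EVERY DIRECTION OF THE GAUGE-INVARIANT BALL, THROUGH THE STAR DOOR**: under the same hypotheses
`s ↦ ∫ F dν(s)` is `ContDiffOn ℝ 1` on `(-s₀, s₀)`. -/
theorem contDiffOn_integral_direction_star (hd : 1 ≤ d) {β ε₀ ε₁ ε₀V ε₁V s₀ ρ BV L : ℝ} {R RV D : ℕ}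
    (hW : MemBallZdG ε₀ ε₁ R W supp) (hV : MemBallZdG ε₀V ε₁V RV V suppV) (h₀V : 0 ≤ ε₀V) (h₁V : 0 ≤ ε₁V)
    {oscV : Finset (ZdEdge d) → ZdEdge d → ℝ} (hoscV : ∀ X, Dobrushin.IsOscBound (V X) (oscV X))
    (hBV : ∀ c : ZdEdge d, windowLoad d suppV oscV (starWinZd c) ≤ BV) (hBV0 : 0 ≤ BV) (hs₀ : 0 < s₀)
    (hD : max R RV + 2 ≤ D) (hρ0 : 0 ≤ ρ) (hρ1 : ρ < 1)
    (hwin : ∀ (T : Set (Finset (ZdEdge d))) (s : ℝ), |s| ≤ s₀ → StarWindowBoundZdR d N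
      (perturbedYM (d := d) (fundamentalRep (Fin N)) (N * β) (W + s • T.indicator V) (fun Λ => supp Λ ∪ suppV Λ)) D ρ suFrobDist)
    {lipV : Finset (ZdEdge d) → ZdEdge d → ℝ} (hlipV : ∀ X, IsLipBound suFrobDist (V X) (lipV X))
    (hLs : ∀ e, Summable fun X : Finset (ZdEdge d) => (if e ∈ X then ∑ y ∈ X, lipV X y else 0))
    (hL : ∀ e, ∑' X : Finset (ZdEdge d), (if e ∈ X then ∑ y ∈ X, lipV X y else 0) ≤ L)
    {ν : ℝ → Measure (LGConfig d (SUN N))}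
    (hν : ∀ s ∈ Set.Icc (-s₀) s₀, ν s ∈ perturbedGibbsMeasures (d := d) (fundamentalRep (Fin N)) (N * β) (W + s • V)
      (fun Λ => supp Λ ∪ suppV Λ))
    {F : LGConfig d (SUN N) → ℝ} (hFm : Measurable F) {ΛF : Finset (ZdEdge d)} (hFdep : DependsOn F (↑ΛF : Set (ZdEdge d)))
    {MF : ℝ} (hMF : ∀ σ, |F σ| ≤ MF) {δF : ZdEdge d → ℝ} (hδF : IsLipBound suFrobDist F δF) :
    ContDiffOn ℝ 1 (fun s => ∫ U, F U ∂(ν s)) (Set.Ioo (-s₀) s₀) := by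
  obtain ⟨hder, hcont⟩ := hasDerivAt_and_continuousOn_direction_star hd hW hV h₀V h₁V hoscV hBV hBV0 hs₀ hD hρ0 hρ1 hwin hlipV hLs hL hν
    hFm hFdep hMF hδF
  exact Summit.Ventures.YMGap.CouplingResponse.contDiffOn_one_of_hasDerivAt hder hcont.neg

end Main

end Summit.Ventures.YMGap.RobustBall

end
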